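import Literature.Probability.Percolation.KozmaNitzanPhiSuperadditive
import HarnessLib

/-!
# `NoHeavyLowerTail` (stmt-CriticalPhenomena-4575) — the two-mark cluster inequality: BHK steps and the
# superadditivity cell (4a)  (prim-hp-2 gen 26, MEMO-gen26 §4; part 1 of 2)

Support file (`--supports stmt-CriticalPhenomena-4575`, hull-port prover `prim-hp-2`, gen 26).  No definitions, no
named facts, no sorries; standard axioms.

Setting: Bernoulli bond percolation with arbitrary edge probabilities `w` on a finite vertex type (`μ = prodBernoulli w`),
four vertices `s` (source), `x` (avoided), `o`, `a` (marks).  Write `Q = μ(· | s ↮ x)`, `C_s` for the open cluster of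
`s`, `p = Q(a ∈ C_s)` and `κ_M = μ(o ↔ a | a ↮ s, a ↮ x, s ↮ x)` (the probability that `o` hangs on `a` in the world where
`a, s, x` are pairwise separated).  The conjectured inequality (II) of MEMO-gen26 §3 — the endpoint of Kozma–Nitzan's box for
the cluster-domination form of their pre-FKG inequality (3) at `|A| = 3` — says that for every increasing function `U` of
`C_s`, `Cov_Q(1{o ∈ C_s}, U) ≥ κ_M · Cov_Q(1{a ∈ C_s}, U)`.  This file PROVES it for the indicator of every up-family `𝒰` of
vertex sets all of whose members contain `a` (the principal filter of `{a ∈ C_s}`; in all numerics the binding direction):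

THIS FILE (part 1): the set identities, the three set-source BHK steps (`bhk_pair_upfamily`, `bhk_pair_conn`,
`bhk_pair_sep`), the Lemma-1 step (`lemma1_step`) and
* `KNGoodTwoMark.superadditive_M` — (4a): `μ(D∩{s~a}∩{s~o})·μ(M) ≥ μ(D∩{s~a})·μ(M ∩ ({a~o} ∪ {s~o}))`, i.e.
  `Q(o ∈ C_s | a ∈ C_s) ≥ μ(o ↔ a | M) + μ(o ↔ s | M)` (Kozma–Nitzan Lemma 1 + the `M`-form of Lemma 2).
Part 2 (`…KNGoodTwoMarkFilter.lean`): (4b) = (Φ1) and (4c) = (II) on the principal filter.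

Ingredients (all tree theorems): the two-set conditional association of van den Berg–Häggström–Kahn in event form
(`KNSep.bhk_set_event_pos/neg`), Kozma–Nitzan's Lemma-1 steps (`KNLemma2.conn_sep_mul_le`) and the disjoint-union
identity on `M` (`KNLemma2.conn_union_inter_eq`).
[cite: VandenbergHaggstromKahn2005, Thms. 1.1–1.5 (pp. 3–8)] [cite: KozmaNitzan2024, §2.2 Lemmas 1–2 (pp. 5–6), §3 (pp. 7–12)]
-/

noncomputable section

namespace Summit.CriticalPhenomena.PercolationContinuityZ3.Theorems

open MeasureTheory Set Literature.Probability.LatticeModels Literature.Probability.Percolation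
open scoped Classical

namespace KNGoodTwoMark

variable {V : Type*}

/-! ### Set identities between the library's set-indexed events and the four-vertex events -/

/-- `{S ↮ T}` for `S = {a, s}`, `T = {x}`. [folklore] -/
theorem sep_pair_eq (a s x : V) :
    {ω : BondConfig V | ∀ s' ∈ ({a, s} : Set V), ∀ t ∈ ({x} : Set V), ¬ (openGraph ω).Reachable s' t} =
      {ω | ¬ (openGraph ω).Reachable a x ∧ ¬ (openGraph ω).Reachable s x} := by
  ext ω; simp

/-- `{S ↮ Y ∪ Z}` for `S = {s}`, `Y = {a}`, `Z = {x}`. [folklore] -/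
theorem sep_single_eq (a s x : V) :
    {ω : BondConfig V | ∀ s' ∈ ({s} : Set V), ∀ t ∈ ({a} : Set V) ∪ {x}, ¬ (openGraph ω).Reachable s' t} =
      {ω | ¬ (openGraph ω).Reachable s a ∧ ¬ (openGraph ω).Reachable s x} := by
  ext ω
  simp only [Set.mem_setOf_eq, Set.mem_singleton_iff, Set.mem_union, forall_eq]
  constructor
  · intro h; exact ⟨h a (Or.inl rfl), h x (Or.inr rfl)⟩
  · rintro ⟨h1, h2⟩ t (rfl | rfl) <;> assumption

/-- `{Y ↮ Z}` for singletons. [folklore] -/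
theorem sep_singletons_eq (a x : V) :
    {ω : BondConfig V | ∀ s' ∈ ({a} : Set V), ∀ t ∈ ({x} : Set V), ¬ (openGraph ω).Reachable s' t} =
      {ω | ¬ (openGraph ω).Reachable a x} := by
  ext ω; simp

/-- `{o ↔ {s}} = {s ~ o}`. [folklore] -/
theorem conn_single_eq (s o : V) :
    {ω : BondConfig V | ∃ s' ∈ ({s} : Set V), (openGraph ω).Reachable s' o} = {ω | (openGraph ω).Reachable s o} := by
  ext ω; simp

/-- `{o ↔ {a, s}} = {a ~ o} ∪ {s ~ o}`. [folklore] -/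
theorem conn_pair_eq (a s o : V) :
    {ω : BondConfig V | ∃ s' ∈ ({a, s} : Set V), (openGraph ω).Reachable s' o} =
      {ω | (openGraph ω).Reachable a o ∨ (openGraph ω).Reachable s o} := by
  ext ω; simp

/-- `{o ↔ {a} ∪ {s}} = {a ~ o} ∪ {s ~ o}`. [folklore] -/
theorem conn_union_eq (a s o : V) :
    {ω : BondConfig V | ∃ s' ∈ ({a} : Set V) ∪ {s}, (openGraph ω).Reachable s' o} =
      {ω | (openGraph ω).Reachable a o ∨ (openGraph ω).Reachable s o} := by
  ext ω; simp [or_comm]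

/-! ### The BHK steps -/

variable [Fintype V]

/-- **Set-source BHK step with the source `{a, s}` and the sink `{x}`** (van den Berg–Häggström–Kahn Thm 1.2 for the
edge cluster of a set, event form): for an increasing event `Q` of the cluster union `C_{a,s}`,
`μ(D ∩ {o ↔ {a,s}}) · μ(D ∩ Q) ≤ μ(D) · μ(D ∩ {o ↔ {a,s}} ∩ Q)`, `D = {a ↮ x} ∩ {s ↮ x}`, stated for
`Q = {the vertex cluster of s lies in 𝒰}` with `𝒰` an up-family.
[cite: VandenbergHaggstromKahn2005, Thm. 1.2 with Remark 1 (p. 5)] [cite: KozmaNitzan2024, Lemma 1(i) (pp. 5–6)] -/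
theorem bhk_pair_upfamily (w : Sym2 V → unitInterval) (o a s x : V) (𝒰 : Set (Set V))
    (hU : ∀ W ∈ 𝒰, ∀ W' : Set V, W ⊆ W' → W' ∈ 𝒰) :
    (prodBernoulli w).real ({ω : BondConfig V | ¬ (openGraph ω).Reachable a x ∧ ¬ (openGraph ω).Reachable s x} ∩
        {ω | (openGraph ω).Reachable a o ∨ (openGraph ω).Reachable s o}) *
      (prodBernoulli w).real ({ω : BondConfig V | ¬ (openGraph ω).Reachable a x ∧ ¬ (openGraph ω).Reachable s x} ∩
        {ω | {v | (openGraph ω).Reachable s v} ∈ 𝒰}) ≤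
    (prodBernoulli w).real {ω : BondConfig V | ¬ (openGraph ω).Reachable a x ∧ ¬ (openGraph ω).Reachable s x} *
      (prodBernoulli w).real ({ω : BondConfig V | ¬ (openGraph ω).Reachable a x ∧ ¬ (openGraph ω).Reachable s x} ∩
        ({ω | (openGraph ω).Reachable a o ∨ (openGraph ω).Reachable s o} ∩
         {ω | {v | (openGraph ω).Reachable s v} ∈ 𝒰})) := by
  have hs : s ∈ ({a, s} : Set V) := by simp
  have key := KNSep.bhk_set_event_pos w ({a, s} : Set V) ({x} : Set V)
    (fun C _ => ∃ s' ∈ ({a, s} : Set V), (openGraph C).Reachable s' o)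
    (fun C _ => {v | (openGraph C).Reachable s v} ∈ 𝒰)
    (fun D C C' hCC' h => by
      obtain ⟨s', hs', hso⟩ := h
      exact ⟨s', hs', hso.mono (openGraph_mono hCC')⟩)
    (fun C D D' hDD' h => h)
    (fun D C C' hCC' h => hU _ h _ (fun v hv => SimpleGraph.Reachable.mono (openGraph_mono hCC') hv))
    (fun C D D' hDD' h => h)
  have hP : {ω : BondConfig V | ∃ s' ∈ ({a, s} : Set V),
        (openGraph (⋃ t ∈ ({a, s} : Set V), openEdgeCluster ω t)).Reachable s' o} =
      {ω | (openGraph ω).Reachable a o ∨ (openGraph ω).Reachable s o} := by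
    rw [← conn_pair_eq a s o]
    ext ω; exact (KNLemma2.conn_iff_cluster ω ({a, s} : Set V) o).symm
  have hQ : {ω : BondConfig V | {v | (openGraph (⋃ t ∈ ({a, s} : Set V), openEdgeCluster ω t)).Reachable s v} ∈ 𝒰} =
      {ω | {v | (openGraph ω).Reachable s v} ∈ 𝒰} := by
    ext ω
    have : {v | (openGraph (⋃ t ∈ ({a, s} : Set V), openEdgeCluster ω t)).Reachable s v} =
        {v | (openGraph ω).Reachable s v} := by
      ext v; exact (KNSep.reachable_iff_cluster ω ({a, s} : Set V) hs v).symm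
    simp only [Set.mem_setOf_eq, this]
  rw [sep_pair_eq] at key
  simp only [hP, hQ] at key
  exact key

/-- **BHK, source `{a,s}`, sink `{x}`, with the increasing event `{s ~ a}`**:
`μ(D ∩ {o↔{a,s}}) · μ(D ∩ {s~a}) ≤ μ(D) · μ(D ∩ {o↔{a,s}} ∩ {s~a})`.
[cite: VandenbergHaggstromKahn2005, Thm. 1.2 with Remark 1 (p. 5)] [cite: KozmaNitzan2024, Lemma 1(i) (pp. 5–6)] -/
theorem bhk_pair_conn (w : Sym2 V → unitInterval) (o a s x : V) :
    (prodBernoulli w).real ({ω : BondConfig V | ¬ (openGraph ω).Reachable a x ∧ ¬ (openGraph ω).Reachable s x} ∩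
        {ω | (openGraph ω).Reachable a o ∨ (openGraph ω).Reachable s o}) *
      (prodBernoulli w).real ({ω : BondConfig V | ¬ (openGraph ω).Reachable a x ∧ ¬ (openGraph ω).Reachable s x} ∩
        {ω | (openGraph ω).Reachable s a}) ≤
    (prodBernoulli w).real {ω : BondConfig V | ¬ (openGraph ω).Reachable a x ∧ ¬ (openGraph ω).Reachable s x} *
      (prodBernoulli w).real ({ω : BondConfig V | ¬ (openGraph ω).Reachable a x ∧ ¬ (openGraph ω).Reachable s x} ∩
        ({ω | (openGraph ω).Reachable a o ∨ (openGraph ω).Reachable s o} ∩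
         {ω | (openGraph ω).Reachable s a})) := by
  have hs : s ∈ ({a, s} : Set V) := by simp
  have key := KNSep.bhk_set_event_pos w ({a, s} : Set V) ({x} : Set V)
    (fun C _ => ∃ s' ∈ ({a, s} : Set V), (openGraph C).Reachable s' o)
    (fun C _ => (openGraph C).Reachable s a)
    (fun D C C' hCC' h => by
      obtain ⟨s', hs', hso⟩ := h
      exact ⟨s', hs', hso.mono (openGraph_mono hCC')⟩)
    (fun C D D' hDD' h => h)
    (fun D C C' hCC' h => h.mono (openGraph_mono hCC'))
    (fun C D D' hDD' h => h)
  have hP : {ω : BondConfig V | ∃ s' ∈ ({a, s} : Set V),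
        (openGraph (⋃ t ∈ ({a, s} : Set V), openEdgeCluster ω t)).Reachable s' o} =
      {ω | (openGraph ω).Reachable a o ∨ (openGraph ω).Reachable s o} := by
    rw [← conn_pair_eq a s o]
    ext ω; exact (KNLemma2.conn_iff_cluster ω ({a, s} : Set V) o).symm
  have hQ : {ω : BondConfig V | (openGraph (⋃ t ∈ ({a, s} : Set V), openEdgeCluster ω t)).Reachable s a} =
      {ω | (openGraph ω).Reachable s a} := by
    ext ω; exact (KNSep.reachable_iff_cluster ω ({a, s} : Set V) hs a).symm
  rw [sep_pair_eq] at key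
  simp only [hP, hQ] at key
  exact key

/-- **BHK, source `{a,s}`, sink `{x}`, with the decreasing event `{s ↮ a}`** (negative correlation):
`μ(D) · μ(D ∩ {o↔{a,s}} ∩ {s↮a}) ≤ μ(D ∩ {o↔{a,s}}) · μ(D ∩ {s↮a})`.
[cite: VandenbergHaggstromKahn2005, Thm. 1.3 (p. 6, decreasing case)] [cite: KozmaNitzan2024, Lemma 1(ii) (pp. 5–6)] -/
theorem bhk_pair_sep (w : Sym2 V → unitInterval) (o a s x : V) :
    (prodBernoulli w).real {ω : BondConfig V | ¬ (openGraph ω).Reachable a x ∧ ¬ (openGraph ω).Reachable s x} *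
      (prodBernoulli w).real ({ω : BondConfig V | ¬ (openGraph ω).Reachable a x ∧ ¬ (openGraph ω).Reachable s x} ∩
        ({ω | (openGraph ω).Reachable a o ∨ (openGraph ω).Reachable s o} ∩
         {ω | ¬ (openGraph ω).Reachable s a})) ≤
    (prodBernoulli w).real ({ω : BondConfig V | ¬ (openGraph ω).Reachable a x ∧ ¬ (openGraph ω).Reachable s x} ∩
        {ω | (openGraph ω).Reachable a o ∨ (openGraph ω).Reachable s o}) *
      (prodBernoulli w).real ({ω : BondConfig V | ¬ (openGraph ω).Reachable a x ∧ ¬ (openGraph ω).Reachable s x} ∩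
        {ω | ¬ (openGraph ω).Reachable s a}) := by
  have hs : s ∈ ({a, s} : Set V) := by simp
  have key := KNSep.bhk_set_event_neg w ({a, s} : Set V) ({x} : Set V)
    (fun C _ => ∃ s' ∈ ({a, s} : Set V), (openGraph C).Reachable s' o)
    (fun C _ => ¬ (openGraph C).Reachable s a)
    (fun D C C' hCC' h => by
      obtain ⟨s', hs', hso⟩ := h
      exact ⟨s', hs', hso.mono (openGraph_mono hCC')⟩)
    (fun C D D' hDD' h => h)
    (fun D C C' hCC' h hsa => h (hsa.mono (openGraph_mono hCC')))
    (fun C D D' hDD' h => h)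
  have hP : {ω : BondConfig V | ∃ s' ∈ ({a, s} : Set V),
        (openGraph (⋃ t ∈ ({a, s} : Set V), openEdgeCluster ω t)).Reachable s' o} =
      {ω | (openGraph ω).Reachable a o ∨ (openGraph ω).Reachable s o} := by
    rw [← conn_pair_eq a s o]
    ext ω; exact (KNLemma2.conn_iff_cluster ω ({a, s} : Set V) o).symm
  have hQ : {ω : BondConfig V | ¬ (openGraph (⋃ t ∈ ({a, s} : Set V), openEdgeCluster ω t)).Reachable s a} =
      {ω | ¬ (openGraph ω).Reachable s a} := by
    ext ω
    simp only [Set.mem_setOf_eq]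
    rw [(KNSep.reachable_iff_cluster ω ({a, s} : Set V) hs a)]
  rw [sep_pair_eq] at key
  simp only [hP, hQ] at key
  exact key

/-- **Kozma–Nitzan Lemma 1(i) step** (`KNLemma2.conn_sep_mul_le` with `X = {s}`, `Y = {a}`, `Z = {x}`):
`μ(K ∩ {s~o}) · μ(M) ≤ μ(K) · μ(M ∩ {s~o})`, `K = {s↮a} ∩ {s↮x}`, `M = K ∩ {a↮x}`.
[cite: KozmaNitzan2024, Lemma 1(i) (pp. 5–6)] -/
theorem lemma1_step (w : Sym2 V → unitInterval) (o a s x : V) :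
    (prodBernoulli w).real ({ω : BondConfig V | ¬ (openGraph ω).Reachable s a ∧ ¬ (openGraph ω).Reachable s x} ∩
        {ω | (openGraph ω).Reachable s o}) *
      (prodBernoulli w).real ({ω : BondConfig V | ¬ (openGraph ω).Reachable s a ∧ ¬ (openGraph ω).Reachable s x} ∩
        {ω | ¬ (openGraph ω).Reachable a x}) ≤
    (prodBernoulli w).real {ω : BondConfig V | ¬ (openGraph ω).Reachable s a ∧ ¬ (openGraph ω).Reachable s x} *
      (prodBernoulli w).real ({ω : BondConfig V | ¬ (openGraph ω).Reachable s a ∧ ¬ (openGraph ω).Reachable s x} ∩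
        ({ω | (openGraph ω).Reachable s o} ∩ {ω | ¬ (openGraph ω).Reachable a x})) := by
  have key := KNLemma2.conn_sep_mul_le w ({s} : Set V) ({a} : Set V) ({x} : Set V) o
  rw [sep_single_eq, conn_single_eq, sep_singletons_eq] at key
  exact key

/-! ### Measure bookkeeping -/

/-- `μ(X) = μ(X ∩ Y) + μ(X ∩ Yᶜ)` for events on the finite configuration space. [folklore] -/
theorem real_split (μ : Measure (BondConfig V)) [IsFiniteMeasure μ] (X Y : Set (BondConfig V)) :
    μ.real X = μ.real (X ∩ Y) + μ.real (X ∩ Yᶜ) := by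
  rw [← measureReal_inter_add_sdiff (s := X) (t := Y) MeasurableSet.of_discrete, Set.sdiff_eq]

/-- **(4a) — superadditivity in the `M`-form** (Kozma–Nitzan Lemma 1 + Lemma 2): with `D = {a↮x} ∩ {s↮x}`,
`M = {s↮a} ∩ {s↮x} ∩ {a↮x}`:  `μ(D ∩ {s~a} ∩ {s~o}) · μ(M) ≥ μ(D ∩ {s~a}) · μ(M ∩ ({a~o} ∪ {s~o}))`, i.e.
`Q(o ∈ C_s | a ∈ C_s) ≥ μ(o↔a | M) + μ(o↔s | M)` (the two events are disjoint on `M`).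
[cite: KozmaNitzan2024, Lemmas 1–2 (pp. 5–6)] [cite: VandenbergHaggstromKahn2005, Thms. 1.2–1.3 (pp. 5–6)] -/
theorem superadditive_M (w : Sym2 V → unitInterval) (o a s x : V) :
    (prodBernoulli w).real ({ω : BondConfig V | ¬ (openGraph ω).Reachable a x ∧ ¬ (openGraph ω).Reachable s x} ∩
        {ω | (openGraph ω).Reachable s a}) *
      (prodBernoulli w).real ({ω : BondConfig V | (¬ (openGraph ω).Reachable s a ∧ ¬ (openGraph ω).Reachable s x) ∧
          ¬ (openGraph ω).Reachable a x} ∩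
        {ω | (openGraph ω).Reachable a o ∨ (openGraph ω).Reachable s o}) ≤
    (prodBernoulli w).real ({ω : BondConfig V | ¬ (openGraph ω).Reachable a x ∧ ¬ (openGraph ω).Reachable s x} ∩
        ({ω | (openGraph ω).Reachable s a} ∩ {ω | (openGraph ω).Reachable s o})) *
      (prodBernoulli w).real {ω : BondConfig V | (¬ (openGraph ω).Reachable s a ∧ ¬ (openGraph ω).Reachable s x) ∧
          ¬ (openGraph ω).Reachable a x} := by
  set μ := prodBernoulli w with hμ
  set D : Set (BondConfig V) := {ω | ¬ (openGraph ω).Reachable a x ∧ ¬ (openGraph ω).Reachable s x} with hD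
  set OD : Set (BondConfig V) := {ω | (openGraph ω).Reachable a o ∨ (openGraph ω).Reachable s o} with hOD
  set A : Set (BondConfig V) := {ω | (openGraph ω).Reachable s a} with hA
  set NA : Set (BondConfig V) := {ω | ¬ (openGraph ω).Reachable s a} with hNA
  set M : Set (BondConfig V) := {ω | (¬ (openGraph ω).Reachable s a ∧ ¬ (openGraph ω).Reachable s x) ∧
      ¬ (openGraph ω).Reachable a x} with hM
  set O : Set (BondConfig V) := {ω | (openGraph ω).Reachable s o} with hO
  -- identifications
  have hDNA : D ∩ NA = M := by
    ext ω; simp only [hD, hNA, hM, Set.mem_inter_iff, Set.mem_setOf_eq]; tauto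
  have hDODNA : D ∩ (OD ∩ NA) = M ∩ OD := by
    ext ω; simp only [hD, hNA, hM, hOD, Set.mem_inter_iff, Set.mem_setOf_eq]; tauto
  have hDODA : D ∩ (OD ∩ A) = D ∩ (A ∩ O) := by
    ext ω
    simp only [hD, hA, hO, hOD, Set.mem_inter_iff, Set.mem_setOf_eq]
    constructor
    · rintro ⟨hd, hod, hsa⟩
      refine ⟨hd, hsa, ?_⟩
      rcases hod with hao | hso
      · exact hsa.trans hao
      · exact hso
    · rintro ⟨hd, hsa, hso⟩
      exact ⟨hd, Or.inr hso, hsa⟩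
  have S1 := bhk_pair_conn w o a s x
  have S2 := bhk_pair_sep w o a s x
  rw [← hD, ← hOD, ← hA] at S1
  rw [← hD, ← hOD, ← hNA] at S2
  rw [hDODA] at S1
  rw [hDNA, hDODNA] at S2
  -- S1 : μ(D∩OD)·μ(D∩A) ≤ μ(D)·μ(D∩(A∩O));  S2 : μ(D)·μ(M∩OD) ≤ μ(D∩OD)·μ(M)
  have h0 : 0 ≤ μ.real (D ∩ OD) := measureReal_nonneg
  have h1 : 0 ≤ μ.real (D ∩ A) := measureReal_nonneg
  have h2 : 0 ≤ μ.real D := measureReal_nonneg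
  have h3 : 0 ≤ μ.real M := measureReal_nonneg
  have h4 : 0 ≤ μ.real (M ∩ OD) := measureReal_nonneg
  have h5 : 0 ≤ μ.real (D ∩ (A ∩ O)) := measureReal_nonneg
  -- degenerate cases
  by_cases hd : μ.real D = 0
  · have : μ.real (D ∩ A) = 0 :=
      le_antisymm (hd ▸ measureReal_mono Set.inter_subset_left) measureReal_nonneg
    rw [this, zero_mul]; exact mul_nonneg h5 h3
  by_cases hod : μ.real (D ∩ OD) = 0
  · have hMOD : μ.real (M ∩ OD) = 0 := by
      refine le_antisymm ?_ measureReal_nonneg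
      calc μ.real (M ∩ OD) ≤ μ.real (D ∩ OD) := by
            refine measureReal_mono ?_
            rw [← hDODNA]; exact Set.inter_subset_inter_right _ Set.inter_subset_left
        _ = 0 := hod
    rw [hMOD, mul_zero]; exact mul_nonneg h5 h3
  have hdpos : 0 < μ.real D := lt_of_le_of_ne h2 (Ne.symm hd)
  have hodpos : 0 < μ.real (D ∩ OD) := lt_of_le_of_ne h0 (Ne.symm hod)
  -- multiply S1 and S2
  have prod := mul_le_mul S1 S2 (mul_nonneg h2 h4) (mul_nonneg h2 h5)
  -- μ(D∩OD)μ(D∩A) · μ(D)μ(M∩OD) ≤ μ(D)μ(D∩(A∩O)) · μ(D∩OD)μ(M)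
  have : μ.real (D ∩ OD) * μ.real D * (μ.real (D ∩ A) * μ.real (M ∩ OD)) ≤
      μ.real (D ∩ OD) * μ.real D * (μ.real (D ∩ (A ∩ O)) * μ.real M) := by nlinarith [prod]
  exact le_of_mul_le_mul_left this (mul_pos hodpos hdpos)

end KNGoodTwoMark

end Summit.CriticalPhenomena.PercolationContinuityZ3.Theorems
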